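import Summits.ABC.IUTFork.LanaEtaLim
import Summits.ABC.IUTFork.LanaLocalUnits
import Literature.IUT.HodgeArakelov.CohomologyLimitKummerTorsion
import HarnessLib

/-!
# L-LANA objects XI septies: the evaluation law on LANA's `∞θ(Π_v)` REDUCED to the law on `θ(Π_v)` itself

Record-only support file (D-0012; seat abc-iut-c312-4 gen 7, L-LANA level, plan/LLANA-SPEC N14 Step 3/Step 7 and
N13); TAKES NO SIDE on [IUTchIII] Cor. 3.12. Companion of gen 5's `LanaEtaLim.lean` (p424629), whose
`EtaLimSide.containment_of_eval` derives LANA's CONTAINMENT "the image of `ψ_v` … is contained in the image of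
`φ_v`" (§6.2 (g) p. 36) from the Kummer-image link `KummerImageEq` and ONE remaining input: the Galois-evaluation
law "every element of `∞θ(Π_v)` restricts at every decomposition group `D_t` to the Kummer class `κ_t(o)` of an
element `o ∈ O^▷_{v,t}`" ([IUTchII] Cor. 2.5 / [EtTh] Prop. 1.4 (iii) shape) — stated there for the DERIVED set
`∞θ(Π_v) := {x | some positive power of x coincides up to torsion with an element of θ(Π_v)}` (our gloss of §6.2 (d)
p. 34: "IUT II defines a direct-limit enlargement `∞θ(Π_v) ⊆ lim_J H¹(Π_{v,Ÿ}|_J, (l·Δ_Θ)(Π_v))` consisting of elements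
of the direct limit of the cohomologies for which some positive multiple coincides up to torsion with an element
of `θ(Π_v)` [11, Prop. 1.4, p. 238]" — LANA's reference [11] is [IUTchII], PRIMS p. 238 = kurims manuscript p. 27,
the locator of the `Mochizuki2012` cite below). [cite: LANA2026Report, §6.2 (d) p. 34, §6.2 (g) pp. 35–36]
[cite: Mochizuki2012, Prop 1.4 p.27]

THIS FILE proves that the passage `θ ↦ ∞θ` costs nothing: **the evaluation law on `∞θ(Π_v)` FOLLOWS from the
evaluation law on `θ(Π_v)` itself**, for a BIJECTIVE cyclotomic synchronization `c : Λ(K̄_vˣ) ⥲ (l·Δ_Θ)(Π_v)` and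
an integral structure `O^▷` that is ROOT-CLOSED in `K̄_vˣ` (`aⁿ ∈ O^▷ ⇒ a ∈ O^▷`; so it contains the roots of unity) — a
THEOREM for the valuation monoid `O^▷_{K̄_v} = {a | |a| ≤ 1}` (§0.4 (b) p. 8), §2 below. Mechanism (classical Kummer theory,
[cite: NeukirchSchmidtWingberg2008, II §7]): if `x ∈ ∞θ`, say `xⁿ/θ₀` torsion with `res_t θ₀ = κ_t(o₀)`, pick an
`n`-th root `a` of `o₀` in the rootable module `K̄_vˣ`; then `(res_t x / κ_t a)ⁿ` is torsion, so `res_t x / κ_t a`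
is a TORSION class of `∞H¹(D_t, (l·Δ_Θ)) = lim_K H¹(D_t ⊓ K, ·)`, hence — abc-iut-w5-d098's
`CohomologySystemOfContH1.exists_h1LimKummer_eq_of_isOfFinAddOrder` (p-id of `CohomologyLimitKummerTorsion.lean`,
consumed BY NAME) — the Kummer class `κ_t(ζ)` of a root of unity `ζ`; so `res_t x = κ_t(a·ζ)` with
`(a·ζ)^{n·m} = o₀^m ∈ O^▷`, i.e. `a·ζ ∈ O^▷` by root-closure.

PROVED (§1, generic over gen 5's `EtaLimSide`): `exists_kappaD_eq_of_isOfFinOrder` (torsion classes at `D_t` are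
`κ_t` of roots of unity), `exists_kappaD_eq_of_pow_div` (the mechanism), **`eval_thetaInfSet_of_thetaClasses`**
(law on `∞θ` ⟸ law on `θ`; hypotheses: `c` bijective and `O^▷` root-closed — NOTHING ELSE),
**`containment_of_eval_thetaClasses`** / `factors_of_eval_thetaClasses` (LANA's Containment, resp. the §9.1 (f)
factorisation, ⟸ `KummerImageEq` ∧ the law on `θ(Π_v)` itself). §2: the integral structure `O^▷ ⊆ K̄ˣ` of a
valued field read inside the unit group (`intMonoidUnits w`, the module of `EtaLimSide` being `K̄_vˣ`) is
root-closed (hence contains every element of finite order, which even lies in `O^×`). §3: the corollary at gen 5's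
model `EtaLimSide.ofDoubleUnderline` over layer L6's genuine `Π^tp_X̲̲` ([IUTchII] §1) with `O^▷ := {|·| ≤ 1} ⊆ ℚ̄_pˣ`.
HONEST SCOPE: the law on `θ(Π_v)` itself remains the input (abc-iut-w4-d004's `CohomologyLimitKummerEvaluation`
reduces it, for `θ` presented as the Kummer class of a function, to the value identity `ev_t(Θ̈-root) = q_t` of
[EtTh] Prop. 1.4 (ii)/(iii) — layer L2); nothing here judges whether it holds at the genuine theta data.
[cite: LANA2026Report, §6.2 pp. 33–36, §9.1 (f) p. 45] NOT here: any judgement.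
v2 (doc-only, declarations byte-identical): the §6.2 (d) quotation above is now VERBATIM from the report (referee lane q,
DEFECT d8 LOW: v1 compressed its head and could be read as attributing [IUTchII] Prop. 1.4's wording to LANA p. 34).
-/

noncomputable section

namespace Summit.ABC
namespace IUTFork

open Literature.AnabelianGeometry.EtaleTheta
open Literature.IUT.HodgeArakelov
open Literature.IUT.HodgeArakelov.CohomologySystemOfContH1

/-! ## 1. Generic: the evaluation law on `∞θ` from the law on `θ` -/

namespace EtaLimSide

variable {P : TopGroup.{0}} {G' : Type} [Group G'] [TopologicalSpace G'] [IsTopologicalGroup G']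
  {φ : P →* G'} {A' : Subgroup G'} [A'.Normal] [IsMulCommutative A'] {H : Subgroup P}
  {A : Type} [CommGroup A] [MulDistribMulAction P A] [TopologicalSpace A] [RootableBy A ℕ]
  (S : EtaLimSide φ A' H A)

/-- **Torsion classes of `∞H¹(D_t, A')` are Kummer classes of roots of unity**: for a bijective synchronization
`c`, every element of finite order of `∞H¹(D_t, A') = lim_K H¹(D_t ⊓ K, A')` is `κ_{D_t}(u)` for some `u ∈ A` of
finite order (abc-iut-w5-d098's `exists_h1LimKummer_eq_of_isOfFinAddOrder` at the subgroup `D_t`).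
[cite: NeukirchSchmidtWingberg2008, II §7] [cite: LANA2026Report, §6.2 (g) p. 35] -/
theorem exists_kappaD_eq_of_isOfFinOrder (hc : Function.Bijective S.c.hom) (t : S.T)
    {z : Multiplicative (h1Lim φ A' (S.D t) ⊥)} (hz : IsOfFinOrder z) :
    ∃ u : A, IsOfFinOrder u ∧ S.kappaD t u = z := by
  obtain ⟨u, hu, h⟩ := exists_h1LimKummer_eq_of_isOfFinAddOrder φ A' (S.D t) S.c S.hA S.hfi hc
    (Multiplicative.toAdd z) ((isOfFinOrder_ofAdd_iff (x := Multiplicative.toAdd z)).mp hz)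
  exact ⟨u, hu, h⟩

/-- **The mechanism.** Let `O^▷ ≤ A` be root-closed (`aⁿ ∈ O^▷, n > 0 ⇒ a ∈ O^▷`; in particular `O^▷`
contains every element of finite order of `A`), and let `c` be bijective. If `y ∈ ∞H¹(D_t, A')` has `yⁿ / κ_t(o)` of finite order for some
`n > 0` and `o ∈ O^▷`, then `y = κ_t(o')` for some `o' ∈ O^▷`: with `a` an `n`-th root of `o` in the rootable `A`,
`y / κ_t(a)` has finite order, so equals `κ_t(ζ)` with `ζ` of finite order `m`, and `o' := a·ζ` has
`o'^{n m} = o^m ∈ O^▷`. [cite: NeukirchSchmidtWingberg2008, II §7] [cite: LANA2026Report, §6.2 (d) p. 34, §6.2 (g) p. 36] -/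
theorem exists_kappaD_eq_of_pow_div (hc : Function.Bijective S.c.hom)
    (hroot : ∀ (a : A) (n : ℕ), 0 < n → a ^ n ∈ S.O → a ∈ S.O)
    (t : S.T) {y : Multiplicative (h1Lim φ A' (S.D t) ⊥)} {n : ℕ} (hn : 0 < n) (o : S.O)
    (h : IsOfFinOrder (y ^ n / S.kappaD t (o : A))) : ∃ o' : S.O, S.kappaD t (o' : A) = y := by
  have hn0 : n ≠ 0 := Nat.pos_iff_ne_zero.mp hn
  -- an `n`-th root `a` of `o` in the rootable module `A`
  have han : (RootableBy.root (o : A) n) ^ n = (o : A) := RootableBy.root_cancel (o : A) hn0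
  set a : A := RootableBy.root (o : A) n with ha
  -- `(y / κ a)ⁿ = yⁿ / κ o` has finite order, hence so does `y / κ a`
  have h1 : IsOfFinOrder ((y / S.kappaD t a) ^ n) := by
    rwa [div_pow, ← map_pow, han]
  obtain ⟨u, hu, hκu⟩ := S.exists_kappaD_eq_of_isOfFinOrder hc t (h1.of_pow hn0)
  -- `a * u ∈ O^▷` by root-closure: `(a u)^(n m) = o^m`
  obtain ⟨m, hm, hum⟩ := hu.exists_pow_eq_one
  have hau : a * u ∈ S.O := by
    refine hroot (a * u) (n * m) (Nat.mul_pos hn hm) ?_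
    rw [mul_pow, pow_mul, han, pow_mul', hum, one_pow, mul_one]
    exact pow_mem o.2 m
  exact ⟨⟨a * u, hau⟩, by rw [map_mul, hκu, mul_div_cancel]⟩

/-- **The evaluation law on `∞θ(Π_v)` FOLLOWS from the evaluation law on `θ(Π_v)`** (bijective `c`; `O^▷`
root-closed): if every theta class `θ₀ ∈ θ(Π_v)` restricts at every `D_t` into
`κ_t(O^▷)`, so does every `x ∈ ∞θ(Π_v)` — `xⁿ/θ₀` torsion, `res_t` a homomorphism, and `exists_kappaD_eq_of_pow_div`.
[cite: LANA2026Report, §6.2 (d) p. 34, §6.2 (g) p. 36] [cite: Mochizuki2012, Prop 1.4 p.27] -/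
theorem eval_thetaInfSet_of_thetaClasses (hc : Function.Bijective S.c.hom)
    (hroot : ∀ (a : A) (n : ℕ), 0 < n → a ^ n ∈ S.O → a ∈ S.O)
    (hθ : ∀ t, ∀ x ∈ S.thetaClasses, S.toEtaSteps.res t x ∈ MonoidHom.mrange (S.toEtaSteps.kappa t)) :
    ∀ t, ∀ x ∈ S.thetaInfSet, S.toEtaSteps.res t x ∈ MonoidHom.mrange (S.toEtaSteps.kappa t) := by
  intro t x hx
  obtain ⟨n, hn, θ₀, hθ₀, hfin⟩ := hx
  obtain ⟨o, ho⟩ := hθ t θ₀ hθ₀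
  have h1 : IsOfFinOrder (S.toEtaSteps.res t x ^ n / S.toEtaSteps.res t θ₀) := by
    rw [← map_pow, ← map_div]
    exact (S.toEtaSteps.res t).isOfFinOrder hfin
  rw [← ho] at h1
  obtain ⟨o', ho'⟩ := S.exists_kappaD_eq_of_pow_div hc hroot t hn o h1
  exact ⟨o', ho'⟩

/-- Hence **the whole étale-like theta monoid `M^Θ = O^×(Π_v)·⟨∞θ(Π_v)⟩` restricts into `κ_t(O^▷)`** granted the
law on `θ(Π_v)` only (units part: gen 5's `res_unit_mem_mrange_kappa`). [cite: LANA2026Report, §6.2 (d) p. 34, §6.2 (g) p. 36] -/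
theorem thetaMonoidEt_le_comap_of_thetaClasses (hc : Function.Bijective S.c.hom)
    (hroot : ∀ (a : A) (n : ℕ), 0 < n → a ^ n ∈ S.O → a ∈ S.O)
    (hθ : ∀ t, ∀ x ∈ S.thetaClasses, S.toEtaSteps.res t x ∈ MonoidHom.mrange (S.toEtaSteps.kappa t)) (t : S.T) :
    S.toEtaSteps.thetaMonoidEt ≤ (MonoidHom.mrange (S.toEtaSteps.kappa t)).comap (S.toEtaSteps.res t) :=
  S.thetaMonoidEt_le_comap t (S.eval_thetaInfSet_of_thetaClasses hc hroot hθ t)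

/-- **LANA's CONTAINMENT from the Kummer-image link and the evaluation law on `θ(Π_v)` ITSELF** (bijective `c`;
`O^▷` root-closed): "the image of `ψ_v` … is contained in the image of `φ_v`" (p. 36). The `∞θ`-step
of gen 5's `containment_of_eval` is now a theorem. [cite: LANA2026Report, §6.2 (g) p. 36] [cite: Mochizuki2012, Cor 2.5 p.71] -/
theorem containment_of_eval_thetaClasses (hc : Function.Bijective S.c.hom)
    (hroot : ∀ (a : A) (n : ℕ), 0 < n → a ^ n ∈ S.O → a ∈ S.O)
    (hK : S.toEtaSteps.KummerImageEq)
    (hθ : ∀ t, ∀ x ∈ S.thetaClasses, S.toEtaSteps.res t x ∈ MonoidHom.mrange (S.toEtaSteps.kappa t)) :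
    S.toEtaSteps.Containment :=
  S.containment_of_eval hK (S.eval_thetaInfSet_of_thetaClasses hc hroot hθ)

/-- … and the §9.1 (f) factorisation EXISTS (and is unique, gen 5 `factorisation_unique_of`) if moreover the
`κ_{D_t}` are injective. [cite: LANA2026Report, §9.1 (f) p. 45] -/
theorem factors_of_eval_thetaClasses (hc : Function.Bijective S.c.hom) (hinj : ∀ t, Function.Injective (S.kappaD t))
    (hroot : ∀ (a : A) (n : ℕ), 0 < n → a ^ n ∈ S.O → a ∈ S.O)
    (hK : S.toEtaSteps.KummerImageEq)
    (hθ : ∀ t, ∀ x ∈ S.thetaClasses, S.toEtaSteps.res t x ∈ MonoidHom.mrange (S.toEtaSteps.kappa t)) :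
    S.toEtaSteps.Factors :=
  (S.containment_iff_factors_of hinj).mp (S.containment_of_eval_thetaClasses hc hroot hK hθ)

end EtaLimSide

/-! ## 2. The integral structure `O^▷ ⊆ K̄ˣ` read inside the unit group: root-closed, contains the roots of unity -/

section Valued

variable {K : Type} [Field K] {Γ₀ : Type} [LinearOrderedCommGroupWithZero Γ₀] (w : Valuation K Γ₀)

/-- **§0.4 (b)** "`O^▷_k = {a ∈ k | 0 < |a| ≤ 1}`" READ INSIDE `kˣ` (the module of `EtaLimSide` is the unit group
`K̄_vˣ`): the preimage of gen 0's `intMonoid w` under `kˣ → k`. [cite: LANA2026Report, §0.4 (b) p. 8] -/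
def intMonoidUnits : Submonoid Kˣ := (intMonoid w).comap (Units.coeHom K)

/-- Membership: `u ∈ O^▷` iff `|u| ≤ 1` (`0 < |u|` is automatic for a unit). [cite: LANA2026Report, §0.4 (b) p. 8] -/
theorem mem_intMonoidUnits_iff (u : Kˣ) : u ∈ intMonoidUnits w ↔ w (u : K) ≤ 1 :=
  ⟨fun h => h.2, fun h => ⟨(Valuation.pos_iff w).mpr u.ne_zero, h⟩⟩

/-- `O^× ⊆ O^▷` inside `kˣ`. [cite: LANA2026Report, §0.4 (b) p. 8] -/
theorem unitGrp_le_intMonoidUnits : (unitGrp w).toSubmonoid ≤ intMonoidUnits w := fun u hu =>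
  (mem_intMonoidUnits_iff w u).mpr (le_of_eq ((mem_unitGrp_iff w u).mp hu))

/-- **`O^▷` is root-closed in `kˣ`**: `|uⁿ| = |u|ⁿ ≤ 1` with `n > 0` forces `|u| ≤ 1`. [cite: LANA2026Report, §0.4 (b) p. 8] -/
theorem mem_intMonoidUnits_of_pow_mem {u : Kˣ} {n : ℕ} (hn : 0 < n) (h : u ^ n ∈ intMonoidUnits w) :
    u ∈ intMonoidUnits w := by
  rw [mem_intMonoidUnits_iff] at h ⊢
  rw [Units.val_pow_eq_pow_val, map_pow] at h
  exact (pow_le_one_iff (Nat.pos_iff_ne_zero.mp hn)).mp h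

/-- **`O^▷` contains every element of finite order of `kˣ`** (roots of unity have absolute value `1`).
[cite: LANA2026Report, §0.4 (b) p. 8, §3.6 p. 20] -/
theorem mem_intMonoidUnits_of_isOfFinOrder {u : Kˣ} (hu : IsOfFinOrder u) : u ∈ intMonoidUnits w := by
  obtain ⟨m, hm, hum⟩ := hu.exists_pow_eq_one
  refine mem_intMonoidUnits_of_pow_mem w hm ?_
  rw [hum]
  exact one_mem _

/-- Roots of unity even lie in `O^×`: `|u|^m = 1 ⇒ |u| = 1`. [cite: LANA2026Report, §3.6 p. 20] -/
theorem mem_unitGrp_of_isOfFinOrder {u : Kˣ} (hu : IsOfFinOrder u) : u ∈ unitGrp w := by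
  obtain ⟨m, hm, hum⟩ := hu.exists_pow_eq_one
  have hm0 : m ≠ 0 := Nat.pos_iff_ne_zero.mp hm
  have h : w (u : K) ^ m = 1 := by
    rw [← map_pow, ← Units.val_pow_eq_pow_val, hum, Units.val_one, map_one]
  exact (mem_unitGrp_iff w u).mpr (le_antisymm ((pow_le_one_iff hm0).mp h.le) ((one_le_pow_iff hm0).mp h.ge))

end Valued

/-! ## 3. At the model `Π := Π^tp_X̲̲` of layer L6 with `O^▷ := {a ∈ ℚ̄_pˣ | |a| ≤ 1}` -/

section Model

open Literature.IUT.HodgeArakelov.EtaleThetaDataOfSetting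

variable {p : ℕ} [Fact p.Prime] {D : ThetaSetting p} {E : D.EtaleThetaData} {l : ℕ} (C : E.DoubleUnderline l)
  [TopologicalSpace (PadicAlgCl p)ˣ] {Γ₀ : Type} [LinearOrderedCommGroupWithZero Γ₀]
  (w : Valuation (PadicAlgCl p) Γ₀)

/-- **At gen 5's model** `EtaLimSide.ofDoubleUnderline` (layer L6's genuine `Π^tp_X̲̲`, `Π_{v,Ÿ} := Π^tp_Ÿ̲̲`,
`A := ℚ̄_pˣ`) with the GENUINE integral structure `O^▷ := {|·| ≤ 1}`, `O^× := {|·| = 1}` of any valuation `w` on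
`ℚ̄_p` (e.g. gen 0's `padicVal p`) and a bijective synchronization `c`: the evaluation law on `∞θ` follows from the
law on `θ`, with NO further hypothesis. [cite: LANA2026Report, §6.2 (d) p. 34, §6.2 (g) p. 36] [cite: Mochizuki2012, Prop 1.4 p.27] -/
theorem EtaLimSide.ofDoubleUnderline_eval_thetaInfSet_of_thetaClasses
    (c : CyclotomeCoefficients (phi C) (D.lDeltaTheta l) (PadicAlgCl p)ˣ) (hc : Function.Bijective c.hom)
    (θ : Set (Multiplicative (h1Lim (phi C) (D.lDeltaTheta l) (PiYdd C) ⊥))) (q : intMonoidUnits w)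
    (hθ : ∀ t, ∀ x ∈ θ,
      (EtaLimSide.ofDoubleUnderline C c θ (intMonoidUnits w) (unitGrp w) (unitGrp_le_intMonoidUnits w) q).toEtaSteps.res
          t x ∈ MonoidHom.mrange ((EtaLimSide.ofDoubleUnderline C c θ (intMonoidUnits w) (unitGrp w)
          (unitGrp_le_intMonoidUnits w) q).toEtaSteps.kappa t)) :
    ∀ t, ∀ x ∈ (EtaLimSide.ofDoubleUnderline C c θ (intMonoidUnits w) (unitGrp w)
        (unitGrp_le_intMonoidUnits w) q).thetaInfSet,
      (EtaLimSide.ofDoubleUnderline C c θ (intMonoidUnits w) (unitGrp w) (unitGrp_le_intMonoidUnits w) q).toEtaSteps.res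
          t x ∈ MonoidHom.mrange ((EtaLimSide.ofDoubleUnderline C c θ (intMonoidUnits w) (unitGrp w)
          (unitGrp_le_intMonoidUnits w) q).toEtaSteps.kappa t) :=
  (EtaLimSide.ofDoubleUnderline C c θ (intMonoidUnits w) (unitGrp w) (unitGrp_le_intMonoidUnits w)
      q).eval_thetaInfSet_of_thetaClasses hc (fun _ _ hn h => mem_intMonoidUnits_of_pow_mem w hn h) hθ

end Model

end IUTFork

end Summit.ABC

end
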